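import Summits.Ventures.Crystal3D.Theorems.StickyWulffConstantGenericWallFloorRunTops
import Summits.Ventures.Crystal3D.Theorems.StickyWulffConstantGenericWallFloorRunCountUpper
import Summits.Ventures.Crystal3D.Theorems.StickyWulffConstantGenericWallFloorShellCount
import Summits.Ventures.Crystal3D.Theorems.StickyWulffConstantGenericWallFloorAffineSampleDeficit
import Summits.Ventures.Crystal3D.Theorems.StickyWulffConstantCoaxialWallLawFrame
import Literature.Geometry.DiscreteGeometry.KissingNumberThreeProofs
import HarnessLib

/-!
# Credits of the slot ledger: structured run tops, run-convex samples, the rim count, coordination ≤ 12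

HONEST FRAMING. Part of the venture `Summits/Ventures/Crystal3D` (cell `crystal3d-full`), helper for the
crux `GenericWallFloor` (stmt-Ventures-19480) of `route-Ventures-StickyWulffConstant`, line `WallLedgerG`:
bookkeeping bricks of the rigid-bicrystal rung of `stub_twoSlabAdhesion` (slot ledger).  Elementary; rung
credit only.

The ledger `2·D(X) = Σ_{x ∈ X} (12 − deg x)` is bounded below by CREDITS = designated empty slots:
* `card_runTops_le_structured` — the run-top injection of `…RunTops` with the structure of the image
  recorded: every top `q` of an `X`-run seeded from `P` has `q + w ∉ X` and (`q ∈ P` or `q − w ∈ X`) — the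
  "top structure" under which the non-saturation lemma is invoked;
* `runConvex_clampedSample` — the clamped slab sample `(A·Λ₀ + t) ∩ {a ≤ p₂ ≤ b, p₀² + p₁² ≤ ρ²}` is
  run-convex along every lattice direction `A w` (hypothesis of the injection);
* `card_filter_dist_eq_one_le_twelve` — in a `1`-separated configuration every ball has at most twelve
  contacts (`musin2006_kissing_three_holds`), so every ledger term `12 − deg x` is non-negative;
* `card_cellRim_le` — the number of balls of a `1`-separated configuration in the rim
  `{(ρ − 2)² < x₀² + x₁² ≤ ρ², lo ≤ x₂ ≤ hi}` of the cell is `≤ 48 (hi − lo + 2)(ρ − 1)` (`…ShellCount`).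

WHAT THIS IS NOT: nothing about the crux stub beyond these bricks; rung F-C1 not moved.
-/

noncomputable section

namespace Summit.Ventures.Crystal3D.Theorems

open Summit.Ventures.Crystal3D Finset
open Literature.MathematicalPhysics.StatisticalMechanics (fccStacking)
open Literature.Geometry.DiscreteGeometry (musin2006_kissing_three_holds)
open scoped InnerProductSpace

section RunTops

variable {E : Type*} [NormedAddCommGroup E] [NormedSpace ℝ E]

open scoped Classical in
/-- **Run tops inject, with structure.**  `P ⊆ X` finite, `w ≠ 0`, `P` run-convex along `w`.  Then the
number of `w`-run tops of `P` is at most the number of `q ∈ X` with `q + w ∉ X` and (`q ∈ P` or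
`q − w ∈ X`): push each top of a `P`-run forward to the top of the `X`-run containing it. -/
theorem card_runTops_le_structured (X P : Finset E) (w : E) (hw : w ≠ 0) (hPX : P ⊆ X)
    (hconv : ∀ p ∈ P, ∀ d : ℕ, p + ((d : ℕ) : ℝ) • w ∈ P → ∀ k : ℕ, k ≤ d → p + ((k : ℕ) : ℝ) • w ∈ P) :
    (P.filter fun p => p + w ∉ P).card ≤
      (X.filter fun q => q + w ∉ X ∧ (q ∈ P ∨ q - w ∈ X)).card := by
  classical
  have key : ∀ p ∈ P.filter (fun p => p + w ∉ P), ∃ m : ℕ, p + ((m : ℕ) : ℝ) • w ∈ X ∧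
      p + ((m + 1 : ℕ) : ℝ) • w ∉ X ∧ ∀ k : ℕ, k ≤ m → p + ((k : ℕ) : ℝ) • w ∈ X := by
    intro p hp
    exact exists_runTop X p w hw (hPX (Finset.mem_filter.1 hp).1)
  choose! m hm using key
  refine Finset.card_le_card_of_injOn (fun p => p + ((m p : ℕ) : ℝ) • w) ?_ ?_
  · intro p hp
    obtain ⟨hX, hnot, hall⟩ := hm p hp
    rw [Finset.mem_coe, Finset.mem_filter]
    refine ⟨hX, ?_, ?_⟩
    · have : p + ((m p : ℕ) : ℝ) • w + w = p + ((m p + 1 : ℕ) : ℝ) • w := by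
        push_cast; rw [add_smul, one_smul, add_assoc]
      rw [this]; exact hnot
    · rcases Nat.eq_zero_or_pos (m p) with h0 | hpos
      · left
        show p + ((m p : ℕ) : ℝ) • w ∈ P
        rw [h0]; simpa using (Finset.mem_filter.1 hp).1
      · right
        have e : p + ((m p : ℕ) : ℝ) • w - w = p + ((m p - 1 : ℕ) : ℝ) • w := by
          rw [Nat.cast_sub hpos]; push_cast; rw [sub_smul, one_smul]; abel
        rw [e]; exact hall (m p - 1) (by omega)
  · intro p hp p' hp' heq
    simp only at heq
    by_contra hne
    have hpP : p ∈ P := (Finset.mem_filter.1 hp).1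
    have hp'P : p' ∈ P := (Finset.mem_filter.1 hp').1
    have hptop : p + w ∉ P := (Finset.mem_filter.1 hp).2
    have hp'top : p' + w ∉ P := (Finset.mem_filter.1 hp').2
    rcases lt_trichotomy (m p) (m p') with hlt | hEq | hgt
    · have hd : p = p' + (((m p' - m p : ℕ) : ℕ) : ℝ) • w := by
        have h1 : ((m p' : ℕ) : ℝ) = ((m p' - m p : ℕ) : ℝ) + ((m p : ℕ) : ℝ) := by
          push_cast [Nat.cast_sub hlt.le]; ring
        have h2 : p' + ((m p' : ℕ) : ℝ) • w = (p' + ((m p' - m p : ℕ) : ℝ) • w) + ((m p : ℕ) : ℝ) • w := by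
          rw [h1, add_smul, add_assoc]
        rw [h2] at heq
        exact add_right_cancel heq
      have h1le : 1 ≤ m p' - m p := by omega
      have hmem : p' + (((m p' - m p : ℕ) : ℕ) : ℝ) • w ∈ P := by rw [← hd]; exact hpP
      have := hconv p' hp'P (m p' - m p) hmem 1 h1le
      simp at this
      exact hp'top this
    · apply hne
      have : p + ((m p : ℕ) : ℝ) • w = p' + ((m p : ℕ) : ℝ) • w := by rw [heq, hEq]
      exact add_right_cancel this
    · have hd : p' = p + (((m p - m p' : ℕ) : ℕ) : ℝ) • w := by
        have h1 : ((m p : ℕ) : ℝ) = ((m p - m p' : ℕ) : ℝ) + ((m p' : ℕ) : ℝ) := by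
          push_cast [Nat.cast_sub hgt.le]; ring
        have h2 : p + ((m p : ℕ) : ℝ) • w = (p + ((m p - m p' : ℕ) : ℝ) • w) + ((m p' : ℕ) : ℝ) • w := by
          rw [h1, add_smul, add_assoc]
        rw [h2] at heq
        exact (add_right_cancel heq).symm
      have h1le : 1 ≤ m p - m p' := by omega
      have hmem : p + (((m p - m p' : ℕ) : ℕ) : ℝ) • w ∈ P := by rw [← hd]; exact hp'P
      have := hconv p hpP (m p - m p') hmem 1 h1le
      simp at this
      exact hptop this

end RunTops

/-- **Run-convexity of the clamped slab sample.**  The sample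
`P = (A·Λ₀ + t) ∩ {a ≤ p₂ ≤ b, p₀² + p₁² ≤ ρ²}` of a moved fcc lattice is run-convex along `A w` for every
lattice vector `w ∈ Λ₀`: if `p` and `p + d·A w` are in `P` so are the lattice points in between. -/
theorem runConvex_clampedSample
    (A : EuclideanSpace ℝ (Fin 3) ≃ₗᵢ[ℝ] EuclideanSpace ℝ (Fin 3)) (t : EuclideanSpace ℝ (Fin 3))
    (a b ρ : ℝ) (hρ : 0 ≤ ρ) (P : Finset (EuclideanSpace ℝ (Fin 3)))
    (hP : ∀ p, p ∈ P ↔ (p ∈ (fun q => A q + t) '' fccStacking 1 (Real.sqrt (2 / 3)) ∧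
      a ≤ p 2 ∧ p 2 ≤ b ∧ p 0 ^ 2 + p 1 ^ 2 ≤ ρ ^ 2))
    {w : EuclideanSpace ℝ (Fin 3)} (hw : w ∈ fccStacking 1 (Real.sqrt (2 / 3))) :
    ∀ p ∈ P, ∀ d : ℕ, p + ((d : ℕ) : ℝ) • A w ∈ P → ∀ k : ℕ, k ≤ d → p + ((k : ℕ) : ℝ) • A w ∈ P := by
  intro p hp d hd k hk
  -- the convex region, written with `⟪·, e₃⟫` and the lateral norm
  set e₃ : EuclideanSpace ℝ (Fin 3) := EuclideanSpace.single (2 : Fin 3) (1 : ℝ) with he₃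
  have he₃n : ‖e₃‖ = 1 := by rw [he₃, PiLp.norm_single, norm_one]
  have h2 : ∀ q : EuclideanSpace ℝ (Fin 3), q 2 = ⟪q + 0, e₃⟫_ℝ := by
    intro q; rw [add_zero, he₃, EuclideanSpace.inner_single_right]; simp
  have hlat : ∀ q : EuclideanSpace ℝ (Fin 3), q 0 ^ 2 + q 1 ^ 2 = ‖q + 0‖ ^ 2 - ⟪q + 0, e₃⟫_ℝ ^ 2 := by
    intro q; rw [add_zero, sq_add_sq_eq_norm_sq_sub]
  have hconv := convex_offsetSampleRegion e₃ 0 he₃n a (b - a) ρ hρ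
  -- membership of lattice points along the segment
  have hlatt : ∀ n : ℕ, p + ((n : ℕ) : ℝ) • A w ∈
      (fun q => A q + t) '' fccStacking 1 (Real.sqrt (2 / 3)) := by
    intro n
    induction n with
    | zero => simpa using ((hP p).1 hp).1
    | succ n ih =>
      have e : p + ((n + 1 : ℕ) : ℝ) • A w = (p + ((n : ℕ) : ℝ) • A w) + A w := by
        push_cast; rw [add_smul, one_smul, add_assoc]
      rw [e]; exact movedFcc_add_site_mem A t ih hw
  rcases Nat.eq_zero_or_pos d with hd0 | hdpos
  · have hk0 : k = 0 := by omega
    rw [hk0]; simpa using hp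
  rw [hP]
  refine ⟨hlatt k, ?_⟩
  -- `p + k w = (1 − k/d) p + (k/d) (p + d w)` lies in the convex region
  have hpK := ((hP p).1 hp).2
  have hqK := ((hP _).1 hd).2
  rw [h2, hlat] at hpK hqK
  have hdR : (0 : ℝ) < d := by exact_mod_cast hdpos
  have hkd : ((k : ℕ) : ℝ) ≤ d := by exact_mod_cast hk
  have hmem := hconv (x := p) (y := p + ((d : ℕ) : ℝ) • A w)
    ⟨hpK.1, by linarith [hpK.2.1], hpK.2.2⟩ ⟨hqK.1, by linarith [hqK.2.1], hqK.2.2⟩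
    (a := 1 - (k : ℝ) / d) (b := (k : ℝ) / d)
    (by rw [sub_nonneg, div_le_one hdR]; exact hkd) (by positivity) (by ring)
  have hcvx : (1 - (k : ℝ) / d) • p + ((k : ℝ) / d) • (p + ((d : ℕ) : ℝ) • A w) =
      p + ((k : ℕ) : ℝ) • A w := by
    rw [smul_add, smul_smul, div_mul_cancel₀ _ hdR.ne']
    module
  rw [hcvx] at hmem
  obtain ⟨h1, h2', h3⟩ := hmem
  rw [← h2] at h1 h2'
  rw [← hlat] at h3
  exact ⟨h1, by linarith, h3⟩

/-- **At most twelve contacts** at any ball of a `1`-separated configuration (the kissing number of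
`ℝ³`, `musin2006_kissing_three_holds`). -/
theorem card_filter_dist_eq_one_le_twelve (X : Finset (EuclideanSpace ℝ (Fin 3)))
    (hsep : ∀ p ∈ X, ∀ q ∈ X, p ≠ q → 1 ≤ dist p q) (x : EuclideanSpace ℝ (Fin 3)) :
    (X.filter fun q => dist x q = 1).card ≤ 12 := by
  classical
  set K := X.filter fun q => dist x q = 1 with hK
  set T : Finset (EuclideanSpace ℝ (Fin 3)) := K.image (fun q => q - x) with hT
  have hinj : Set.InjOn (fun q : EuclideanSpace ℝ (Fin 3) => q - x) ↑K :=
    fun a _ b _ h => sub_left_injective h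
  have hTcard : T.card = K.card := by rw [hT, card_image_of_injOn hinj]
  have hnorm : ∀ v ∈ T, ‖v‖ = 1 := by
    intro v hv
    obtain ⟨q, hq, rfl⟩ := mem_image.1 hv
    rw [← dist_eq_norm, dist_comm]
    exact (mem_filter.1 hq).2
  have hdist : ∀ v ∈ T, ∀ w ∈ T, v ≠ w → 1 ≤ dist v w := by
    intro v hv w hw hvw
    obtain ⟨a, ha, rfl⟩ := mem_image.1 hv
    obtain ⟨b, hb, rfl⟩ := mem_image.1 hw
    have hab : a ≠ b := fun h => hvw (by rw [h])
    rw [dist_eq_norm, sub_sub_sub_cancel_right, ← dist_eq_norm]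
    exact hsep a (mem_filter.1 ha).1 b (mem_filter.1 hb).1 hab
  have h12 := musin2006_kissing_three_holds T hnorm hdist
  omega

/-- **The rim count.**  In a `1`-separated configuration inside `{lo ≤ x₂ ≤ hi}`, the balls with
lateral radius in `(ρ − 2, ρ]` number at most `48 (hi − lo + 2)(ρ − 1)` (`ρ ≥ 3`). -/
theorem card_cellRim_le (X : Finset (EuclideanSpace ℝ (Fin 3)))
    (hsep : ∀ p ∈ X, ∀ q ∈ X, p ≠ q → 1 ≤ dist p q) (lo hi ρ : ℝ) (hlohi : lo ≤ hi) (hρ : 3 ≤ ρ)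
    (hcell : ∀ p ∈ X, lo ≤ p 2 ∧ p 2 ≤ hi ∧ p 0 ^ 2 + p 1 ^ 2 ≤ ρ ^ 2) :
    (((X.filter fun p => (ρ - 2) ^ 2 < p 0 ^ 2 + p 1 ^ 2).card : ℕ) : ℝ) ≤
      48 * (hi - lo + 2) * (ρ - 1) := by
  classical
  set S := X.filter fun p => (ρ - 2) ^ 2 < p 0 ^ 2 + p 1 ^ 2 with hS
  have hSsep : ∀ p ∈ S, ∀ q ∈ S, p ≠ q → 1 ≤ dist p q :=
    fun p hp q hq hpq => hsep p (mem_filter.1 hp).1 q (mem_filter.1 hq).1 hpq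
  have hmem : ∀ p ∈ S, lo ≤ p 2 ∧ p 2 ≤ hi ∧ (ρ - 2) ^ 2 < p 0 ^ 2 + p 1 ^ 2 ∧
      p 0 ^ 2 + p 1 ^ 2 ≤ ρ ^ 2 := by
    intro p hp
    obtain ⟨hpX, hpr⟩ := mem_filter.1 hp
    obtain ⟨h1, h2, h3⟩ := hcell p hpX
    exact ⟨h1, h2, hpr, h3⟩
  have key := card_mul_le_of_separated_in_shell S hSsep lo hi (ρ - 2) ρ hlohi (by linarith) (by linarith)
    hmem
  have e : (hi - lo + 2) * (Real.pi * (ρ + 1) ^ 2 - Real.pi * (ρ - 2 - 1) ^ 2) =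
      (Real.pi / 6) * (48 * (hi - lo + 2) * (ρ - 1)) := by ring
  rw [e] at key
  have hπ : 0 < Real.pi / 6 := by positivity
  nlinarith

end Summit.Ventures.Crystal3D.Theorems

end
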